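import Literature.AlgebraicGeometry.Frobenioids.PerfFactorial
import Literature.AnabelianGeometry.EtaleTheta.RealificationCoordinates

/-!
# The realification `M^rlf` of a perf-factorial monoid in coordinates (source side of [EtTh] Lemma 3.5)

Source: S. Mochizuki, *The étale theta function …* [MochizukiEtTh2009], Lemma 3.5, PDF pp. 75–76
(printed 301–302); objects from [FrdI] Def. 2.4 (i) [MochizukiFrdI2008] (tree:
`Frobenioids/PerfFactorial.lean` — `IsPerfFactorial`, `factorMap`, `IsPerfFactorial.realification`,
`IsPerfFactorial.toRealification`).

The printed proof of the "`P^rlf`" portion of Lemma 3.5 manipulates `P^pf ⊆ P^rlf ⊆ ∏_𝔭 P^rlf_𝔭`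
prime by prime: "for every `a ∈ P^rlf`, there exists an `a' ∈ P^pf` such that `a' ≥ a`", "the primary
components `a_𝔭 ∈ P_𝔭` of `a`", "if `a ≥ b`, then there exist `a', b' ∈ P^pf` such that `a' ≥ a`,
`b' ≤ b`, `a' ≥ b'`" (pp. 75–76). This file packages those manipulations, stub-free, as ONE coordinate
statement `exists_coordinates` for a perf-factorial `M` all of whose `M^pf_𝔮` are monoprime: there is an
injective homomorphism `cR : M^rlf → ∏_𝔮 ℝ_{≥0}` such that

1. `cR` is an order embedding for `≤ = ∣` on `M^rlf`, with downward closed image;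
2. `M^pf → M^rlf → ∏ ℝ_{≥0}` is an order embedding for `≤ = ∣` on `M^pf` (order reflection uses
   [FrdI] Def. 2.4 (i)(d));
3. SUPPORT GAUGES: every `x ∈ M^rlf` is supported inside some `b ∈ M^pf`;
4. APPROXIMATION: for `x ∈ M^rlf` and any `e ∈ M^pf` non-trivial on the support of `x` there is
   `a ∈ M^pf` with `a ≤ x ≤ a · e` (again via Def. 2.4 (i)(d)).

The hypothesis "`M^pf_𝔮` monoprime" is [FrdI] Def. 2.4 (i)(b) for `M^pf`, i.e. a consequence of the
tree's named fact `PerfectionIsPerfFactorial M` ("`M^pf` is perf-factorial", Def. 2.4 (i) p. 48); it is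
carried as an explicit hypothesis here. Proof-only (no definitions). Seat abc-iut-L2-d2 (cell abc-iut,
node EtTh:Lem3.5 rlf portion, step 3/4).
-/

namespace Literature.AnabelianGeometry.EtaleTheta

namespace RlfCoord

open Literature.AlgebraicGeometry.Frobenioids NNReal Function RealificationCoord

universe u

variable {M : Type u} [CommMonoid M]

/-- **Coordinates for `M^rlf`.** For a perf-factorial `M` whose `M^pf_𝔮` are monoprime there is an
injective homomorphism `cR : M^rlf → ∏_𝔮 ℝ_{≥0}` (the inclusion `M^rlf ⊆ M^rlf_factor` of [FrdI]
Def. 2.4 (i) in coordinates `M^rlf_𝔮 ≅ ℝ_{≥0}`) such that: `cR` is an order embedding for `∣` with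
downward closed image; `M^pf → M^rlf` composed with `cR` is an order embedding for `∣` on `M^pf`; every
`x ∈ M^rlf` has a support gauge `b ∈ M^pf`; and every `x ∈ M^rlf` is approximable as `a ≤ x ≤ a · e` by
`a ∈ M^pf` for any `e ∈ M^pf` non-trivial on the support of `x` (the prime-by-prime manipulations of
the proof of [EtTh] Lemma 3.5, pp. 75–76). [cite: MochizukiEtTh2009, Lem 3.5 p.75] -/
theorem exists_coordinates (hP : IsPerfFactorial M)
    (hb : ∀ 𝔮 : Primes (Perfection M), IsMonoprime (PfAt M 𝔮)) :
    ∃ cR : hP.Rlf →* (Primes (Perfection M) → Multiplicative ℝ≥0),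
      Injective cR ∧
      (∀ x y : hP.Rlf, x ∣ y ↔ cR x ≤ cR y) ∧
      (∀ (s : Primes (Perfection M) → Multiplicative ℝ≥0) (y : hP.Rlf), s ≤ cR y → s ∈ Set.range cR) ∧
      (∀ a b : Perfection M, a ∣ b ↔ cR (hP.toRealification a) ≤ cR (hP.toRealification b)) ∧
      (∀ x : hP.Rlf, ∃ b : Perfection M,
        ∀ 𝔮, cR x 𝔮 ≠ 1 → cR (hP.toRealification b) 𝔮 ≠ 1) ∧
      (∀ (x : hP.Rlf) (e : Perfection M),
        (∀ 𝔮, cR x 𝔮 ≠ 1 → cR (hP.toRealification e) 𝔮 ≠ 1) →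
        ∃ a : Perfection M, cR (hP.toRealification a) ≤ cR x ∧
          cR x ≤ cR (hP.toRealification (a * e))) := by
  classical
  let f : ∀ 𝔮 : Primes (Perfection M), RlfAt M 𝔮 ≃* Multiplicative ℝ≥0 :=
    fun 𝔮 => Classical.choice (nonempty_coord (hb 𝔮))
  let Fe : RlfFactor M ≃* (Primes (Perfection M) → Multiplicative ℝ≥0) := MulEquiv.piCongrRight f
  let cR : hP.Rlf →* (Primes (Perfection M) → Multiplicative ℝ≥0) :=
    Fe.toMonoidHom.comp hP.realification.subtype
  have hc : ∀ (x : hP.Rlf) (𝔮 : Primes (Perfection M)), cR x 𝔮 = f 𝔮 (x.1 𝔮) := fun _ _ => rfl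
  have hcA : ∀ (a : Perfection M) (𝔮 : Primes (Perfection M)),
      cR (hP.toRealification a) 𝔮 = f 𝔮 (factorMap M a 𝔮) := fun _ _ => rfl
  have hsharp : ∀ 𝔮 : Primes (Perfection M), IsSharp (RlfAt M 𝔮) := fun 𝔮 => isSharp_realification _
  -- (2) order reflection on `M^pf`, used twice below
  have hordA : ∀ a b : Perfection M, a ∣ b ↔ cR (hP.toRealification a) ≤ cR (hP.toRealification b) := by
    intro a b
    refine ⟨fun h => (pi_mnnreal_dvd_iff_le _ _).mp (map_dvd _ (map_dvd _ h)), fun h => ?_⟩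
    obtain ⟨xa, hxa⟩ := hP.factorMap_mem_range a
    obtain ⟨xb, hxb⟩ := hP.factorMap_mem_range b
    have hd : ∀ 𝔮 : Primes (Perfection M), xa 𝔮 ∣ xb 𝔮 := by
      intro 𝔮
      apply dvd_of_coord_le (f 𝔮) (hb 𝔮)
      have h𝔮 := h 𝔮
      rw [hcA, hcA, ← hxa, ← hxb, pfFactorToRlfFactor_apply, pfFactorToRlfFactor_apply] at h𝔮
      exact h𝔮
    choose d hd using hd
    have hsupp : supp (pfFactorToRlfFactor M d) ⊆ supp (factorMap M b) := by
      intro 𝔮 h𝔮 hy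
      apply h𝔮
      rw [← hxb, pfFactorToRlfFactor_apply, hd 𝔮, map_mul] at hy
      rw [pfFactorToRlfFactor_apply]
      exact (hsharp 𝔮).1 _ (IsUnit.of_mul_eq_one _ (by rwa [mul_comm] at hy))
    obtain ⟨z, hz⟩ := hP.mem_range_of_supp_subset d b hsupp
    refine ⟨z, hP.factorMap_injective ?_⟩
    rw [hP.factorMap_mul, hz, ← hxa, ← hxb, ← map_mul]
    congr 1
    funext 𝔮
    exact hd 𝔮
  refine ⟨cR, ?_, fun x y => ⟨fun h => ?_, fun h => ?_⟩, fun s y hs => ?_, hordA, fun x => ?_,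
    fun x e he => ?_⟩
  · -- injective
    exact Fe.injective.comp Subtype.val_injective
  · -- `x ∣ y ⇒ cR x ≤ cR y`
    exact (pi_mnnreal_dvd_iff_le _ _).mp (map_dvd cR h)
  · -- `cR x ≤ cR y ⇒ x ∣ y`: the coordinatewise quotient has admissible support
    obtain ⟨by_, hby⟩ := y.2
    have ht : ∀ 𝔮 : Primes (Perfection M), ∃ t : RlfAt M 𝔮, y.1 𝔮 = x.1 𝔮 * t := by
      intro 𝔮
      obtain ⟨t, ht⟩ := le_iff_exists_mul.mp (h 𝔮)
      refine ⟨(f 𝔮).symm t, (f 𝔮).injective ?_⟩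
      rw [map_mul, MulEquiv.apply_symm_apply, ← hc, ← hc]
      exact ht
    choose t ht using ht
    have htmem : (fun 𝔮 => t 𝔮) ∈ hP.realification := by
      refine ⟨by_, fun 𝔮 h𝔮 => hby fun hy => h𝔮 ?_⟩
      have hy' := ht 𝔮
      rw [hy] at hy'
      exact (hsharp 𝔮).1 _ (IsUnit.of_mul_eq_one _ (by rw [mul_comm]; exact hy'.symm))
    refine ⟨⟨fun 𝔮 => t 𝔮, htmem⟩, Subtype.ext (funext fun 𝔮 => ?_)⟩
    exact ht 𝔮
  · -- downward closed
    obtain ⟨by_, hby⟩ := y.2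
    let s' : RlfFactor M := fun 𝔮 => (f 𝔮).symm (s 𝔮)
    have hs'mem : s' ∈ hP.realification := by
      refine ⟨by_, fun 𝔮 h𝔮 => hby fun hy => h𝔮 ?_⟩
      have hs𝔮 : s 𝔮 ≤ 1 := by
        have := hs 𝔮
        rwa [hc, hy, map_one] at this
      show (f 𝔮).symm (s 𝔮) = 1
      rw [le_antisymm hs𝔮 one_le, map_one]
    refine ⟨⟨s', hs'mem⟩, funext fun 𝔮 => ?_⟩
    rw [hc]
    exact (f 𝔮).apply_symm_apply (s 𝔮)
  · -- support gauge
    obtain ⟨b, hbx⟩ := x.2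
    refine ⟨b, fun 𝔮 h𝔮 hb𝔮 => h𝔮 ?_⟩
    rw [hcA, EmbeddingLike.map_eq_one_iff] at hb𝔮
    rw [hc, EmbeddingLike.map_eq_one_iff]
    by_contra hx
    exact hbx hx hb𝔮
  · -- approximation `a ≤ x ≤ a · e`
    obtain ⟨bx, hbx⟩ := x.2
    obtain ⟨xe, hxe⟩ := hP.factorMap_mem_range e
    have hA : ∀ 𝔮 : Primes (Perfection M), ∃ a : PfAt M 𝔮,
        Multiplicative.toAdd (f 𝔮 (Realification.of _ a)) ≤ Multiplicative.toAdd (f 𝔮 (x.1 𝔮)) ∧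
        Multiplicative.toAdd (f 𝔮 (x.1 𝔮)) ≤
          Multiplicative.toAdd (f 𝔮 (Realification.of _ (a * xe 𝔮))) := by
      intro 𝔮
      by_cases hx : x.1 𝔮 = 1
      · refine ⟨1, ?_, ?_⟩
        · rw [hx, map_one, map_one]
        · rw [hx, map_one, toAdd_one]; exact zero_le
      · have hε : xe 𝔮 ≠ 1 := by
          intro h1
          apply he 𝔮 (by rwa [hc, Ne, EmbeddingLike.map_eq_one_iff])
          rw [hcA, ← hxe, pfFactorToRlfFactor_apply, h1, map_one, map_one]
        exact exists_approx (f 𝔮) (hb 𝔮) _ hε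
    choose a ha using hA
    have hsupp : supp (pfFactorToRlfFactor M a) ⊆ supp (factorMap M bx) := by
      intro 𝔮 h𝔮 hb𝔮
      apply h𝔮
      have hx : x.1 𝔮 = 1 := by
        by_contra hx
        exact hbx hx hb𝔮
      have h0 : Multiplicative.toAdd (f 𝔮 (Realification.of _ (a 𝔮))) = 0 := by
        have := (ha 𝔮).1
        rw [hx, map_one, toAdd_one] at this
        exact le_antisymm this zero_le
      rw [pfFactorToRlfFactor_apply]
      have : a 𝔮 = 1 := coord_injective (f 𝔮) (hb 𝔮) (h0.trans (coord_one (f 𝔮)).symm)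
      rw [this, map_one]
    obtain ⟨z, hz⟩ := hP.mem_range_of_supp_subset a bx hsupp
    refine ⟨z, fun 𝔮 => ?_, fun 𝔮 => ?_⟩
    · show Multiplicative.toAdd (cR (hP.toRealification z) 𝔮) ≤ Multiplicative.toAdd (cR x 𝔮)
      rw [hcA, hc, hz, pfFactorToRlfFactor_apply]
      exact (ha 𝔮).1
    · show Multiplicative.toAdd (cR x 𝔮) ≤ Multiplicative.toAdd (cR (hP.toRealification (z * e)) 𝔮)
      rw [hcA, hc, hP.factorMap_mul, Pi.mul_apply, hz, ← hxe, pfFactorToRlfFactor_apply,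
        pfFactorToRlfFactor_apply, ← map_mul]
      exact (ha 𝔮).2

/-- `M^rlf` is sharp and its order `∣` is antisymmetric (it embeds in `∏ ℝ_{≥0}`); in particular a
homomorphism out of `M^rlf` that reflects `∣` is injective. [cite: MochizukiEtTh2009, Lem 3.5 p.75] -/
theorem dvd_antisymm (hP : IsPerfFactorial M) (hb : ∀ 𝔮 : Primes (Perfection M), IsMonoprime (PfAt M 𝔮))
    {x y : hP.Rlf} (h₁ : x ∣ y) (h₂ : y ∣ x) : x = y := by
  obtain ⟨cR, hinj, hord, -⟩ := exists_coordinates hP hb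
  exact hinj (le_antisymm ((hord x y).mp h₁) ((hord y x).mp h₂))

/-! ### Coordinate-free corollaries used by the extension theorem -/

/-- **Order embedding `M^pf ↪ M^rlf`.** For `a, b ∈ M^pf`: `a ≤ b` in `M^rlf` iff `a ≤ b` in `M^pf`
("[by the portion of assertion (ii) concerning '`P^pf`'] … `a' ≥ b'`", [EtTh] p. 76: comparisons of
elements of `P^pf` may be made inside `P^rlf`). [cite: MochizukiEtTh2009, Lem 3.5 p.76] -/
theorem toRealification_dvd_iff (hP : IsPerfFactorial M)
    (hb : ∀ 𝔮 : Primes (Perfection M), IsMonoprime (PfAt M 𝔮)) (a b : Perfection M) :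
    hP.toRealification a ∣ hP.toRealification b ↔ a ∣ b := by
  obtain ⟨cR, -, hord, -, hordA, -⟩ := exists_coordinates hP hb
  rw [hord, hordA]

/-- In `∏ ℝ_{≥0}` a product is trivial at a coordinate only if each factor is. [cite: MochizukiFrdI2008, §0 p.10] -/
private theorem mnnreal_eq_one_of_mul_eq_one {a b : Multiplicative ℝ≥0} (h : a * b = 1) : b = 1 :=
  le_antisymm ((le_mul_self (b := a)).trans h.le) one_le

/-- **Gauges and roots.** Every `x ∈ M^rlf` admits a gauge `b ∈ M^pf` with `x ≤ b` such that for
every `n ≥ 1` there is `a ∈ M^pf` with `a ≤ x ≤ a · b^{1/n}` (in `M^rlf`): the two-sided form of "for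
every `a ∈ P^rlf`, there exists an `a' ∈ P^pf` such that `a' ≥ a`" and "there exist `a', b' ∈ P^pf`
such that `a' ≥ a`, `b' ≤ b`" ([EtTh] pp. 75–76), with the gap an `n`-th root of a fixed element.
[cite: MochizukiEtTh2009, Lem 3.5 p.75] -/
theorem exists_gauge (hP : IsPerfFactorial M)
    (hb : ∀ 𝔮 : Primes (Perfection M), IsMonoprime (PfAt M 𝔮)) (x : hP.Rlf) :
    ∃ b : Perfection M, x ∣ hP.toRealification b ∧
      ∀ n : ℕ+, ∃ a : Perfection M, hP.toRealification a ∣ x ∧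
        x ∣ hP.toRealification (a * isPerfect_perfection.root n b) := by
  obtain ⟨cR, -, hord, -, -, hgauge, happrox⟩ := exists_coordinates hP hb
  obtain ⟨b₀, hb₀⟩ := hgauge x
  obtain ⟨a₀, -, ha₀⟩ := happrox x b₀ hb₀
  refine ⟨a₀ * b₀, (hord _ _).mpr ha₀, fun n => ?_⟩
  have he : isPerfect_perfection.root n (a₀ * b₀) ^ (n : ℕ) = a₀ * b₀ := IsPerfect.root_pow _ n _
  have hsupp : ∀ 𝔮, cR x 𝔮 ≠ 1 →
      cR (hP.toRealification (isPerfect_perfection.root n (a₀ * b₀))) 𝔮 ≠ 1 := by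
    intro 𝔮 hx h1
    apply hb₀ 𝔮 hx
    have h2 : cR (hP.toRealification (a₀ * b₀)) 𝔮 = 1 := by
      rw [← he, map_pow, map_pow, Pi.pow_apply, h1, one_pow]
    rw [map_mul, map_mul, Pi.mul_apply] at h2
    exact mnnreal_eq_one_of_mul_eq_one h2
  obtain ⟨a, ha1, ha2⟩ := happrox x _ hsupp
  exact ⟨a, (hord _ _).mpr ha1, (hord _ _).mpr ha2⟩

/-- A nonnegative real below `b + C/n` for every `n ≥ 1` is `≤ b`. [cite: MochizukiFrdI2008, §0 p.10] -/
private theorem nnreal_le_of_forall_le_add_div {a b C : ℝ≥0} (h : ∀ n : ℕ+, a ≤ b + C / n) : a ≤ b := by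
  by_contra hab
  replace hab : b < a := not_le.mp hab
  obtain ⟨δ, hδ, hδ'⟩ : ∃ δ : ℝ≥0, 0 < δ ∧ b + δ < a := by
    refine ⟨(a - b) / 2, by simpa using hab, ?_⟩
    have : b + (a - b) = a := add_tsub_cancel_of_le hab.le
    have h2 : (a - b) / 2 < a - b := NNReal.half_lt_self (ne_of_gt (tsub_pos_of_lt hab))
    calc b + (a - b) / 2 < b + (a - b) := by gcongr
      _ = a := this
  obtain ⟨n, hn⟩ := exists_nat_gt (C / δ)
  have hnpos : 0 < n := by
    rcases Nat.eq_zero_or_pos n with h0 | h0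
    · rw [h0, Nat.cast_zero] at hn; exact absurd hn (not_lt.mpr zero_le)
    · exact h0
  have key := h ⟨n, hnpos⟩
  have hCn : C / (n : ℝ≥0) < δ := by
    rw [div_lt_iff₀ (by exact_mod_cast hnpos)]
    calc C = (C / δ) * δ := (div_mul_cancel₀ C hδ.ne').symm
      _ < n * δ := by gcongr
      _ = δ * n := mul_comm _ _
  have : a < a := calc
    a ≤ b + C / (n : ℝ≥0) := key
    _ < b + δ := by gcongr
    _ < a := hδ'
  exact lt_irrefl _ this

/-- **Archimedean property of `M^rlf`.** If `x ≤ y · E_n` for `n`-th roots `E_n` of a fixed `C ∈ M^rlf`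
and every `n ≥ 1`, then `x ≤ y` (coordinatewise: `a ≤ b + c/n` for all `n` forces `a ≤ b`).
[cite: MochizukiEtTh2009, Lem 3.5 p.76] -/
theorem dvd_of_forall_root (hP : IsPerfFactorial M)
    (hb : ∀ 𝔮 : Primes (Perfection M), IsMonoprime (PfAt M 𝔮)) {x y C : hP.Rlf}
    (h : ∀ n : ℕ+, ∃ E : hP.Rlf, E ^ (n : ℕ) = C ∧ x ∣ y * E) : x ∣ y := by
  obtain ⟨cR, -, hord, -⟩ := exists_coordinates hP hb
  refine (hord x y).mpr fun i => ?_
  show Multiplicative.toAdd (cR x i) ≤ Multiplicative.toAdd (cR y i)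
  apply nnreal_le_of_forall_le_add_div (C := Multiplicative.toAdd (cR C i))
  intro n
  obtain ⟨E, hE, hxE⟩ := h n
  have h1 : Multiplicative.toAdd (cR x i) ≤ Multiplicative.toAdd (cR y i) + Multiplicative.toAdd (cR E i) := by
    have := (hord _ _).mp hxE i
    rwa [map_mul, Pi.mul_apply] at this
  have h2 : (n : ℝ≥0) * Multiplicative.toAdd (cR E i) = Multiplicative.toAdd (cR C i) := by
    rw [← hE, map_pow, Pi.pow_apply, toAdd_pow, nsmul_eq_mul]
  have hn : (n : ℝ≥0) ≠ 0 := by exact_mod_cast n.pos.ne'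
  rw [← h2, mul_div_cancel_left₀ _ hn]
  exact h1

end RlfCoord

end Literature.AnabelianGeometry.EtaleTheta
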